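import Summits.Parity.GeneralizedHardyLittlewood.Theorems.CosetDecorrelation.Negative.CosetDecorrelationWindow
import Summits.Parity.GeneralizedHardyLittlewood.Theorems.DilatedChowla.Negative.DilatedChowlaMirror

/-!
# Strategist mirror for `CosetDecorrelation` (stmt-Parity-13317):
# the coset crux ALONE contains an effective Landau–Siegel theorem

Crux-strategist work file (unit `cstrat-stmt-Parity-13317-p1`, 2026-08-17), census heading NEGATION.
Kernel-checked here (no `sorry`), for the disprover / an idle prover to land verbatim at
`Theorems/CosetDecorrelation/Negative/CosetDecorrelationSiegelMirror.lean` `--supports stmt-Parity-13317`.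

THEOREM (`cosetSiegelMirror`).
`CosetDecorrelation → ∃ C₀ > 0, ¬ SiegelZerosAbove (C₀ · log)`: under the coset crux (already its single
instance `c = 1`, one modulus `j = ⌊√M⌋+1`, dilations `n = qν ≤ 2M`), Siegel zeros of quality
`η ≥ C₀ log q` (Tao–Teräväinen Def. 1.4, tree `IsSiegelZero`) do not occur at arbitrarily large
conductors; equivalently (`cosetSiegelMirror_realZeroFree`) `L(σ, χ) ≠ 0` for all large `q`, all primitive
quadratic `χ mod q`, all `σ ∈ [1 − 1/(C₀ log² q), 1)`.  Unconditionally only Siegel's ineffective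
`1 − β ≥ C(ε) q^{−ε}` is known.

This supersedes the record "the crux has no certifiable one-point content / no rigorous crux ⇒ zero-free
statement is within reach" (IdeatorMemo4 §3(w), §5.5; Ideator5Memo §1.3, R5): the node's mirror
(`DilatedChowla.Negative.siegelMirror`, which needs BOTH MAD cruxes to reach the coset crux) holds for the
coset crux by itself, WITHOUT `FanDecorrelation`.

MECHANISM (`not_cosetDecorrelation_of_coherentBias`, the coset analogue of the node's Gram lever
`not_dilatedChowla_of_coherentBias`).  Let `CoherentBias c` hold (tree def: for every `κ > 0`, `C'` a
family of `V` progressions `c mod qν`, `ν ≤ V`, `qV ≤ 2M`, whose one-point sums `P c (qν) M = Σ_{m∼M} λ(mqν+c)`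
share a sign and are `≥ bM`, with `b²V ≥ 4`, `V·C' ≤ M^κ`).  POSITIVITY AMPLIFIER restricted to that family
(`amplifier`): with `A_n(a) = Σ_{m≡a (j)} λ(mn+c)` and `W(a) = Σ_ν A_{qν}(a)`,
`(Σ_ν P c (qν) M)² = (Σ_a W(a))² ≤ j Σ_a W(a)² = j Σ_{ν,ν'} T_j(qν, qν')`.
Diagonal: `j · T_j(n,n) ≤ (2M + j)M ≤ 3M²` (`j ≤ M`); off-diagonal: the crux, `j · V² · C M^{3/4+ϑ} ≤ (V/2)M²`
once `V · 4C ≤ M^{3/4−ϑ}` — which is exactly what `CoherentBias` supplies at `κ := 3/4 − ϑ`, `C' := 4C`.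
Hence `(VbM)² ≤ (7/2)·V·M²`, i.e. `b²V ≤ 7/2 < 4`.  The Siegel input is the node's LANDED chain
`coherentBias_one_of_siegelZerosAbove` (Landau two-pole method for `M(x,ψ)`, transfer to `λ`, orthogonality,
undamping `log(2kM) ≤ η log q`), used as a black box.

WHY IT MATTERS FOR THE CENSUS.  (i) The crux is Landau–Siegel-hard through its DILATIONS (`n = qν`), at every
modulus `j` of the window, prime or not — independent of the `q ∣ j` pretender clause of its why-might-fail,
which is void at prime `j` (Ideator5Memo §1.2(iii)).  (ii) The route's declared condition `ElliottHalberstam`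
is Siegel-blind, so any proof of the crux proves something EH does not give.  (iii) Contrapositive
(`CosetDecorrelation_false_of_siegelZerosAbove`): Siegel zeros of every logarithmic quality at arbitrarily
large conductors refute the crux — the ONLY conditional disproof available (the Tao–Teräväinen pretender
route is vacuous, census §Negation N2).
-/

noncomputable section

namespace Summit.Parity.GeneralizedHardyLittlewood.Cruxes.CosetDecorrelation.StrategistMirror

open Finset
open Summit.Parity.GeneralizedHardyLittlewood.Theses.LiouvilleMAD (CosetDecorrelation)
open Summit.Parity.GeneralizedHardyLittlewood.Theorems.CosetDecorrelation.Negative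
  (u cosetW T crux_iff cosetW_eq_classInner abs_u_le_one abs_cosetW_le)
open Summit.Parity.GeneralizedHardyLittlewood.Theorems.CosetDecorrelation.FareyLevelMeanCoupling
  (normalForm_sum_classSum)
open Summit.Parity.GeneralizedHardyLittlewood.Theorems.DilatedChowla.Negative
  (P CoherentBias SiegelZerosAbove abs_P_le coherentBias_one_of_siegelZerosAbove
    realZeroFree_of_not_siegelZerosAbove)
open Literature.Barriers.Parity (IsSiegelZero)

/-! ## §1 Dictionary and the positivity amplifier over a dilation family -/

/-- The node mirror's one-point sum is the crux's progression sum: `P c n M = Σ_{m∈(M,2M]} λ(mn+c)`. -/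
theorem P_eq_sum_u (c : ℤ) (n M : ℕ) : P c n M = ∑ m ∈ Ioc M (2 * M), u n c m := rfl

/-- POSITIVITY AMPLIFIER over the dilation family `qν`, `ν ∈ [1, V]`, at one modulus `j ≥ 1`:
`(Σ_ν P c (qν) M)² ≤ j · Σ_{ν,ν'} T c (qν) (qν') M j`
(class decomposition `P = Σ_a A(a)`, `T = Σ_a A(a)A'(a)`, and Cauchy–Schwarz over the `j` classes). -/
theorem amplifier (c : ℤ) (M j q V : ℕ) (hj : 1 ≤ j) :
    (∑ ν ∈ Icc 1 V, P c (q * ν) M) ^ 2 ≤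
      (j : ℝ) * ∑ ν ∈ Icc 1 V, ∑ ν' ∈ Icc 1 V, T c (q * ν) (q * ν') M j := by
  set A : ℕ → ℕ → ℝ :=
    fun n a => ∑ m ∈ (Ioc M (2 * M)).filter (fun m => m ≡ a [MOD j]), u n c m with hA
  have hP : ∀ n, P c n M = ∑ a ∈ range j, A n a := fun n => by
    rw [P_eq_sum_u]
    exact (normalForm_sum_classSum (u n c) M j hj).symm
  have hT : ∀ n n', T c n n' M j = ∑ a ∈ range j, A n a * A n' a := fun n n' =>
    cosetW_eq_classInner (u n c) (u n' c) M j hj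
  have hL : ∑ ν ∈ Icc 1 V, P c (q * ν) M = ∑ a ∈ range j, ∑ ν ∈ Icc 1 V, A (q * ν) a := by
    rw [sum_congr rfl fun ν _ => hP (q * ν), sum_comm]
  have hR : ∑ ν ∈ Icc 1 V, ∑ ν' ∈ Icc 1 V, T c (q * ν) (q * ν') M j =
      ∑ a ∈ range j, (∑ ν ∈ Icc 1 V, A (q * ν) a) ^ 2 := by
    calc ∑ ν ∈ Icc 1 V, ∑ ν' ∈ Icc 1 V, T c (q * ν) (q * ν') M j
        = ∑ ν ∈ Icc 1 V, ∑ ν' ∈ Icc 1 V, ∑ a ∈ range j, A (q * ν) a * A (q * ν') a :=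
          sum_congr rfl fun ν _ => sum_congr rfl fun ν' _ => hT _ _
      _ = ∑ ν ∈ Icc 1 V, ∑ a ∈ range j, ∑ ν' ∈ Icc 1 V, A (q * ν) a * A (q * ν') a :=
          sum_congr rfl fun ν _ => sum_comm
      _ = ∑ a ∈ range j, ∑ ν ∈ Icc 1 V, ∑ ν' ∈ Icc 1 V, A (q * ν) a * A (q * ν') a := sum_comm
      _ = ∑ a ∈ range j, (∑ ν ∈ Icc 1 V, A (q * ν) a) ^ 2 := by
          refine sum_congr rfl fun a _ => ?_
          rw [sq, sum_mul_sum]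
  rw [hL, hR]
  have h := sum_mul_sq_le_sq_mul_sq (range j) (fun _ => (1 : ℝ))
    (fun a => ∑ ν ∈ Icc 1 V, A (q * ν) a)
  simp only [one_pow, sum_const, card_range, nsmul_eq_mul, mul_one, one_mul] at h
  exact h

/-! ## §2 The family Gram sum under the crux -/

/-- Under the crux's bound at shift `c` (exponent `3/4 + ϑ`, constant `C`), for the family `qν`,
`1 ≤ ν ≤ V`, `q ≥ 1`, `qV ≤ 2M`, at the modulus `j = ⌊√M⌋ + 1`:
`Σ_{ν,ν'} T c (qν) (qν') M j ≤ V·(2M/j + 1)·M + V²·C·M^{3/4+ϑ}`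
(diagonal: trivial bound `abs_cosetW_le`; off-diagonal: the crux). -/
theorem family_sum_le {c : ℤ} {ϑ C : ℝ} {M q V : ℕ}
    (hC : ∀ n n' j : ℕ, 1 ≤ n → 1 ≤ n' → n ≠ n' → n ≤ 2 * M → n' ≤ 2 * M →
      Nat.sqrt M + 1 ≤ j → j < 2 * (Nat.sqrt M + 1) → |T c n n' M j| ≤ C * (M : ℝ) ^ (3 / 4 + ϑ))
    (hq : 1 ≤ q) (hqV : q * V ≤ 2 * M) :
    ∑ ν ∈ Icc 1 V, ∑ ν' ∈ Icc 1 V, T c (q * ν) (q * ν') M (Nat.sqrt M + 1) ≤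
      (V : ℝ) * ((2 * (M : ℝ) / ((Nat.sqrt M + 1 : ℕ) : ℝ) + 1) * M) +
        (V : ℝ) * ((V : ℝ) * (C * (M : ℝ) ^ (3 / 4 + ϑ))) := by
  have hj : 1 ≤ Nat.sqrt M + 1 := by omega
  have hentry : ∀ ν ∈ Icc 1 V, ∀ ν' ∈ Icc 1 V,
      T c (q * ν) (q * ν') M (Nat.sqrt M + 1) ≤
        (if ν = ν' then (2 * (M : ℝ) / ((Nat.sqrt M + 1 : ℕ) : ℝ) + 1) * M else 0) +
          C * (M : ℝ) ^ (3 / 4 + ϑ) := by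
    intro ν hν ν' hν'
    rw [mem_Icc] at hν hν'
    have hn : 1 ≤ q * ν := (one_mul 1).symm.trans_le (Nat.mul_le_mul hq hν.1)
    have hn' : 1 ≤ q * ν' := (one_mul 1).symm.trans_le (Nat.mul_le_mul hq hν'.1)
    have hnM : q * ν ≤ 2 * M := le_trans (Nat.mul_le_mul_left q hν.2) hqV
    have hn'M : q * ν' ≤ 2 * M := le_trans (Nat.mul_le_mul_left q hν'.2) hqV
    by_cases hνν' : ν = ν'
    · subst hνν'
      rw [if_pos rfl]
      have h1 := abs_cosetW_le (u (q * ν) c) (u (q * ν) c) (abs_u_le_one _ c) (abs_u_le_one _ c)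
        M (Nat.sqrt M + 1) hj
      have h2 : T c (q * ν) (q * ν) M (Nat.sqrt M + 1) ≤
          (2 * (M : ℝ) / ((Nat.sqrt M + 1 : ℕ) : ℝ) + 1) * M := by
        unfold T
        exact le_trans (le_abs_self _) h1
      -- the off-diagonal allowance is nonnegative: test the crux at a genuine off-diagonal pair if
      -- one exists, else use `C * M^… ≥ |T| ≥ 0` at `(qν, qν')` — here simply via `ν' := ν` case split
      have h3 : 0 ≤ C * (M : ℝ) ^ (3 / 4 + ϑ) := by
        -- the pair (1, 2) is admissible as soon as `2 ≤ 2M`, i.e. `M ≥ 1`, which `qν ≤ 2M` forces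
        have hM : 1 ≤ M := by
          have := Nat.mul_le_mul hq hν.1
          omega
        have := hC 1 2 (Nat.sqrt M + 1) le_rfl (by norm_num) (by norm_num) (by omega) (by omega)
          le_rfl (by omega)
        exact le_trans (abs_nonneg _) this
      linarith
    · rw [if_neg hνν', zero_add]
      refine le_trans (le_abs_self _) (hC (q * ν) (q * ν') (Nat.sqrt M + 1) hn hn' ?_ hnM hn'M
        le_rfl (by omega))
      exact fun heq => hνν' (Nat.eq_of_mul_eq_mul_left (by omega) heq)
  calc ∑ ν ∈ Icc 1 V, ∑ ν' ∈ Icc 1 V, T c (q * ν) (q * ν') M (Nat.sqrt M + 1)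
      ≤ ∑ ν ∈ Icc 1 V, ∑ ν' ∈ Icc 1 V,
          ((if ν = ν' then (2 * (M : ℝ) / ((Nat.sqrt M + 1 : ℕ) : ℝ) + 1) * M else 0) +
            C * (M : ℝ) ^ (3 / 4 + ϑ)) :=
        sum_le_sum fun ν hν => sum_le_sum fun ν' hν' => hentry ν hν ν' hν'
    _ = ∑ _ν ∈ Icc 1 V, ((2 * (M : ℝ) / ((Nat.sqrt M + 1 : ℕ) : ℝ) + 1) * M +
          (V : ℝ) * (C * (M : ℝ) ^ (3 / 4 + ϑ))) := by
        refine sum_congr rfl fun ν hν => ?_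
        rw [sum_add_distrib, sum_ite_eq, if_pos hν, sum_const, Nat.card_Icc, Nat.add_sub_cancel,
          nsmul_eq_mul]
    _ = (V : ℝ) * ((2 * (M : ℝ) / ((Nat.sqrt M + 1 : ℕ) : ℝ) + 1) * M) +
          (V : ℝ) * ((V : ℝ) * (C * (M : ℝ) ^ (3 / 4 + ϑ))) := by
        rw [sum_const, Nat.card_Icc, Nat.add_sub_cancel, nsmul_eq_mul, mul_add]

/-! ## §3 The Gram–amplifier lever: a coherent class bias refutes the coset crux -/

/-- **`CoherentBias c → ¬ CosetDecorrelation`** (`c ≠ 0`).  Instantiate the bias at `κ := 3/4 − ϑ`,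
`C' := 4C` (`ϑ, C` the crux's data at shift `c`); then with `j = ⌊√M⌋+1 ≤ min(M, 2√M)`:
`(VbM)² ≤ (Σ_ν P c (qν) M)² ≤ j Σ_{ν,ν'} T ≤ 3VM² + (V/2)M²`, against `b²V ≥ 4`. -/
theorem not_cosetDecorrelation_of_coherentBias {c : ℤ} (hc : c ≠ 0) (h : CoherentBias c) :
    ¬ CosetDecorrelation := by
  intro hCD
  obtain ⟨ϑ, hϑ, C, hC⟩ := crux_iff.mp hCD c hc
  -- the coherent bias at `κ := 3/4 − ϑ > 0`, `C' := 4C`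
  obtain ⟨M, q, V, b, σ, hσ, hq, hV, hqV, hb, hbV, hVC, hP⟩ := h (3 / 4 - ϑ) (by linarith) (4 * C)
  have hM : 1 ≤ M := by
    have := Nat.mul_le_mul hq hV
    omega
  have hMpos : (0 : ℝ) < M := Nat.cast_pos.mpr (by omega)
  have hVpos : (0 : ℝ) < V := Nat.cast_pos.mpr (by omega)
  -- `b ≤ 1` (a one-point sum of `M` unimodular terms), hence `V ≥ b²V ≥ 4` and `M ≥ 2`
  have hb1 : b ≤ 1 := by
    have h1 := hP 1 le_rfl hV
    have hσP : σ * P c (q * 1) M ≤ |P c (q * 1) M| := by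
      rcases hσ with hs | hs
      · rw [hs, one_mul]; exact le_abs_self _
      · rw [hs, neg_one_mul]; exact neg_le_abs _
    have h2 : b * M ≤ 1 * M := by linarith [abs_P_le c (q * 1) M]
    exact le_of_mul_le_mul_right h2 hMpos
  have hV4 : (4 : ℝ) ≤ V := by
    have hb2 : b ^ 2 ≤ 1 := by nlinarith
    nlinarith [hbV, hVpos]
  have hM2 : 2 ≤ M := by
    have hV4' : 4 ≤ V := by exact_mod_cast hV4
    have := Nat.mul_le_mul hq hV4'
    omega
  -- the modulus `j = ⌊√M⌋ + 1`: `1 ≤ j ≤ M`, `j ≤ 2√M`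
  set j := Nat.sqrt M + 1 with hjdef
  have hj1 : 1 ≤ j := by omega
  have hjM : j ≤ M := by
    have := Nat.sqrt_lt_self (show 1 < M by omega)
    omega
  have hjpos : (0 : ℝ) < j := by exact_mod_cast hj1
  have hjR : (j : ℝ) ≤ 2 * Real.sqrt M := by
    have hsq : ((Nat.sqrt M : ℕ) : ℝ) ^ 2 ≤ (M : ℝ) := by exact_mod_cast Nat.sqrt_le' M
    have hs : ((Nat.sqrt M : ℕ) : ℝ) ≤ Real.sqrt M :=
      calc ((Nat.sqrt M : ℕ) : ℝ) = Real.sqrt (((Nat.sqrt M : ℕ) : ℝ) ^ 2) :=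
            (Real.sqrt_sq (Nat.cast_nonneg _)).symm
        _ ≤ Real.sqrt M := Real.sqrt_le_sqrt hsq
    have h1 : (1 : ℝ) ≤ Real.sqrt M := by
      rw [show (1 : ℝ) = Real.sqrt 1 by simp]
      exact Real.sqrt_le_sqrt (by exact_mod_cast hM)
    rw [hjdef]
    push_cast
    linarith
  -- amplifier and the family Gram bound
  have hamp := amplifier c M j q V hj1
  have hfam := family_sum_le (c := c) (ϑ := ϑ) (C := C) (M := M) (q := q) (V := V) (hC M) hq hqV
  -- diagonal: `j · (2M/j + 1) · M = (2M + j) M ≤ 3M²`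
  have hdiag : (j : ℝ) * ((2 * (M : ℝ) / j + 1) * M) ≤ 3 * (M : ℝ) ^ 2 := by
    have hjM' : (j : ℝ) ≤ M := by exact_mod_cast hjM
    have e : (j : ℝ) * ((2 * (M : ℝ) / j + 1) * M) = (2 * M + j) * M := by
      field_simp
    rw [e]
    nlinarith
  -- off-diagonal: `j · V² · C · M^{3/4+ϑ} ≤ (V/2) M²` from `j ≤ 2√M` and `V · 4C ≤ M^{3/4−ϑ}`
  have hC0 : 0 ≤ C := by
    have h12 := hC 1 1 2 2 le_rfl (by norm_num) (by norm_num) (by norm_num) (by norm_num)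
      (by norm_num [Nat.sqrt_one]) (by norm_num [Nat.sqrt_one])
    rw [Nat.cast_one, Real.one_rpow, mul_one] at h12
    exact le_trans (abs_nonneg _) h12
  have hX0 : 0 ≤ (M : ℝ) ^ (3 / 4 + ϑ) := Real.rpow_nonneg hMpos.le _
  have hpow : Real.sqrt M * ((M : ℝ) ^ (3 / 4 - ϑ) * (M : ℝ) ^ (3 / 4 + ϑ)) = (M : ℝ) ^ 2 := by
    rw [← Real.rpow_add hMpos, Real.sqrt_eq_rpow, ← Real.rpow_add hMpos,
      show (1 : ℝ) / 2 + (3 / 4 - ϑ + (3 / 4 + ϑ)) = 2 by ring, Real.rpow_two]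
  have hoff : (j : ℝ) * ((V : ℝ) * ((V : ℝ) * (C * (M : ℝ) ^ (3 / 4 + ϑ)))) ≤
      (V : ℝ) / 2 * (M : ℝ) ^ 2 := by
    have hin0 : 0 ≤ (V : ℝ) * ((V : ℝ) * (C * (M : ℝ) ^ (3 / 4 + ϑ))) :=
      mul_nonneg hVpos.le (mul_nonneg hVpos.le (mul_nonneg hC0 hX0))
    have h2 : (V : ℝ) * (4 * C) * (M : ℝ) ^ (3 / 4 + ϑ) ≤
        (M : ℝ) ^ (3 / 4 - ϑ) * (M : ℝ) ^ (3 / 4 + ϑ) :=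
      mul_le_mul_of_nonneg_right hVC hX0
    calc (j : ℝ) * ((V : ℝ) * ((V : ℝ) * (C * (M : ℝ) ^ (3 / 4 + ϑ))))
        ≤ (2 * Real.sqrt M) * ((V : ℝ) * ((V : ℝ) * (C * (M : ℝ) ^ (3 / 4 + ϑ)))) :=
          mul_le_mul_of_nonneg_right hjR hin0
      _ = (V : ℝ) / 2 * (Real.sqrt M * ((V : ℝ) * (4 * C) * (M : ℝ) ^ (3 / 4 + ϑ))) := by ring
      _ ≤ (V : ℝ) / 2 * (Real.sqrt M * ((M : ℝ) ^ (3 / 4 - ϑ) * (M : ℝ) ^ (3 / 4 + ϑ))) :=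
          mul_le_mul_of_nonneg_left (mul_le_mul_of_nonneg_left h2 (Real.sqrt_nonneg _))
            (by positivity)
      _ = (V : ℝ) / 2 * (M : ℝ) ^ 2 := by rw [hpow]
  -- upper bound for `j · Σ_{ν,ν'} T`
  have hup : (j : ℝ) * ∑ ν ∈ Icc 1 V, ∑ ν' ∈ Icc 1 V, T c (q * ν) (q * ν') M j ≤
      3 * (V : ℝ) * (M : ℝ) ^ 2 + (V : ℝ) / 2 * (M : ℝ) ^ 2 := by
    calc (j : ℝ) * ∑ ν ∈ Icc 1 V, ∑ ν' ∈ Icc 1 V, T c (q * ν) (q * ν') M j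
        ≤ (j : ℝ) * ((V : ℝ) * ((2 * (M : ℝ) / j + 1) * M) +
            (V : ℝ) * ((V : ℝ) * (C * (M : ℝ) ^ (3 / 4 + ϑ)))) :=
          mul_le_mul_of_nonneg_left hfam hjpos.le
      _ = (V : ℝ) * ((j : ℝ) * ((2 * (M : ℝ) / j + 1) * M)) +
            (j : ℝ) * ((V : ℝ) * ((V : ℝ) * (C * (M : ℝ) ^ (3 / 4 + ϑ)))) := by ring
      _ ≤ (V : ℝ) * (3 * (M : ℝ) ^ 2) + (V : ℝ) / 2 * (M : ℝ) ^ 2 :=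
          add_le_add (mul_le_mul_of_nonneg_left hdiag hVpos.le) hoff
      _ = 3 * (V : ℝ) * (M : ℝ) ^ 2 + (V : ℝ) / 2 * (M : ℝ) ^ 2 := by ring
  -- lower bound from the coherent bias: `V·b·M ≤ σ · Σ_ν P c (qν) M`
  have hbias : (V : ℝ) * (b * M) ≤ σ * ∑ ν ∈ Icc 1 V, P c (q * ν) M := by
    rw [mul_sum]
    have hconst : ∑ _ν ∈ Icc 1 V, b * (M : ℝ) = (V : ℝ) * (b * M) := by
      rw [sum_const, Nat.card_Icc, Nat.add_sub_cancel, nsmul_eq_mul]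
    rw [← hconst]
    refine sum_le_sum fun ν hν => ?_
    rw [mem_Icc] at hν
    exact hP ν hν.1 hν.2
  have hσ2 : σ ^ 2 = 1 := by
    rcases hσ with h1 | h1 <;> norm_num [h1]
  have h0 : (0 : ℝ) ≤ V * (b * M) :=
    mul_nonneg (Nat.cast_nonneg V) (mul_nonneg hb.le (Nat.cast_nonneg M))
  have hsq : ((V : ℝ) * (b * M)) ^ 2 ≤ (∑ ν ∈ Icc 1 V, P c (q * ν) M) ^ 2 := by
    calc ((V : ℝ) * (b * M)) ^ 2 ≤ (σ * ∑ ν ∈ Icc 1 V, P c (q * ν) M) ^ 2 :=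
          pow_le_pow_left₀ h0 hbias 2
      _ = (∑ ν ∈ Icc 1 V, P c (q * ν) M) ^ 2 := by rw [mul_pow, hσ2, one_mul]
  -- conclusion: `V²b²M² ≤ (7/2)·V·M²` against `4 ≤ b²V`
  have hVM : (0 : ℝ) < V * M ^ 2 := mul_pos hVpos (pow_pos hMpos 2)
  have hprod : 4 * ((V : ℝ) * M ^ 2) ≤ b ^ 2 * V * ((V : ℝ) * M ^ 2) :=
    mul_le_mul_of_nonneg_right hbV hVM.le
  nlinarith [hsq, hamp, hup, hprod, hVM]

/-! ## §4 The mirror -/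

/-- **The coset Siegel mirror.**  `CosetDecorrelation` (alone, without `FanDecorrelation`) implies that
Siegel zeros of quality `≥ C₀ log q` do not occur at arbitrarily large conductors. -/
theorem cosetSiegelMirror (h : CosetDecorrelation) :
    ∃ C₀ : ℝ, 0 < C₀ ∧ ¬ SiegelZerosAbove (fun q => C₀ * Real.log q) := by
  obtain ⟨C₀, hC₀, himp⟩ := coherentBias_one_of_siegelZerosAbove
  exact ⟨C₀, hC₀, fun hz => not_cosetDecorrelation_of_coherentBias one_ne_zero (himp hz) h⟩

/-- `_false_of_` form (disprover's index): Siegel zeros of every logarithmic quality at arbitrarily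
large conductors refute the coset crux — the one conditional disproof on record. -/
theorem CosetDecorrelation_false_of_siegelZerosAbove
    (hz : ∀ C₀ : ℝ, 0 < C₀ → SiegelZerosAbove (fun q => C₀ * Real.log q)) : ¬ CosetDecorrelation :=
  fun h => by
    obtain ⟨C₀, hC₀, hno⟩ := cosetSiegelMirror h
    exact hno (hz C₀ hC₀)

/-- The mirror on the tree's predicate: under the coset crux every Siegel zero at a large conductor has
quality `< C₀ log q`. -/
theorem cosetSiegelMirror_quality (h : CosetDecorrelation) :
    ∃ C₀ : ℝ, 0 < C₀ ∧ ∃ q₀ : ℕ, ∀ (q : ℕ) [NeZero q] (χ : DirichletCharacter ℂ q) (η : ℝ),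
      q₀ ≤ q → IsSiegelZero χ η → η < C₀ * Real.log q := by
  obtain ⟨C₀, hC₀, hno⟩ := cosetSiegelMirror h
  refine ⟨C₀, hC₀, ?_⟩
  by_contra hcon
  push Not at hcon
  apply hno
  intro q₀
  obtain ⟨q, hq, χ, η, hq₀, hz, hη⟩ := hcon q₀
  exact ⟨q, hq, χ, η, hq₀, hη, hz⟩

/-- **The coset mirror as a zero-free interval.**  Under `CosetDecorrelation` there are `C₀ > 0` and `q₀`
with `L(σ, χ) ≠ 0` for every `q ≥ q₀`, every primitive quadratic `χ mod q` and every real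
`σ ∈ [1 − 1/(C₀ log² q), 1)` — an EFFECTIVE Landau–Siegel theorem (Siegel: ineffective `q^{−ε}` only). -/
theorem cosetSiegelMirror_realZeroFree (h : CosetDecorrelation) :
    ∃ C₀ : ℝ, 0 < C₀ ∧ ∃ q₀ : ℕ, ∀ (q : ℕ) [NeZero q] (χ : DirichletCharacter ℂ q),
      χ.IsPrimitive → χ.IsQuadratic → q₀ ≤ q →
        ∀ σ : ℝ, 1 - 1 / (C₀ * Real.log q ^ 2) ≤ σ → σ < 1 → χ.LFunction (σ : ℂ) ≠ 0 := by
  obtain ⟨C₀, hC₀, hno⟩ := cosetSiegelMirror h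
  exact ⟨C₀, hC₀, realZeroFree_of_not_siegelZerosAbove hC₀ hno⟩

#print axioms cosetSiegelMirror
#print axioms cosetSiegelMirror_realZeroFree

end Summit.Parity.GeneralizedHardyLittlewood.Cruxes.CosetDecorrelation.StrategistMirror

end
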